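/-
Copyright (c) 2026. All rights reserved.
Released under Apache 2.0 license as described in the file LICENSE.
Authors: abc-iut cell, Cor. 3.12 sub-crew seat abc-iut-c312-5 (gen 8).
-/
import Literature.IUT.LogVolume.UnitLogInnerRadiusTieNoRoots
import Literature.IUT.LogVolume.UnitLogInnerRadiusTieTorsion
import Literature.IUT.LogVolume.UnitLogTorsionPowerCriterion
import Literature.IUT.LogVolume.UnitLogIntoMaximalIdeal
import HarnessLib

/-!
# The inner radius at a TIE index `e = A·(p−1)` (`p` odd), VI: the LEVELS of `p`-th powers of units —
# `‖1 − u^p‖` is never `‖ϖ‖^{A·p−1}`, and (when `f = 1`, `ζ_p ∈ K`) never `‖ϖ‖^{A·p}`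

Proof-only sequel (theorems, no definitions, no named fact) of `UnitLogInnerRadiusTieNoRoots.lean`, first of two
files (`…DeepTiePowers`, `…DeepTie`) proving the UNIVERSAL lower bound `r_in ≥ e/(p−1)` for the inner radius of
the log-unit lattice `Λ = log_p(𝒪_K^×)` at every tie index — the case `ζ_p ∈ K ∧ p ∣ A` (abc-iut-c312-3 parts
I–V and abc-iut-rp-d4 leave exactly this case open; there `r_in ∈ {A, A+1}` genuinely depends on `K`).  This
file is the local input: the possible LEVELS `‖1 − u^p‖` of `p`-th powers of units.  Setting: `K` a proper
ultrametric normed `ℚ_p`-algebra field, `e = absRamificationIdx p K = A·(p−1)`, `ϖ` a norm uniformizer.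

* §0 bookkeeping: `e + A = A·p`, `A + 1 ≤ A·p − 1` (`p` odd), the level `‖1 − u‖ = ‖ϖ‖^m` (`m ≥ 1`) of a
  principal unit `u ≠ 1`.
* §1 **`norm_one_sub_pow_prime_eq_of_deep`** — above the critical level the `p`-th power map shifts the level by
  `e`: `‖1 − w‖ ≤ ‖ϖ‖^{A+1} ⇒ ‖1 − w^p‖ = ‖p‖·‖1 − w‖` (isometry range of `log_p`, `log_p(w^p) = p·log_p w`);
  `norm_one_sub_pow_prime_le_of_level` — at the critical level `‖1 − u^p‖ ≤ ‖ϖ‖^{A·p}`;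
  **`norm_one_sub_pow_prime_ne_pred`** — NO `u : K` has `‖1 − u^p‖ = ‖ϖ‖^{A·p−1}` (levels `a < A` give `a·p`
  by abc-iut-c312-3's level raising, level `A` gives `≥ A·p`, levels `≥ A+1` give `a + e ≥ A·p + 1`);
  (a primitive `p`-th root of unity sits EXACTLY at level `A`: abc-iut-s2-p12's
  `norm_one_sub_eq_pow_level_of_pow_prime_eq_one`, `UnitLogInnerRadiusTieTorsion`, cited BY NAME);
  `norm_one_add_pow_sub_sub_le` — `‖(1+θ)^i − 1 − iθ‖ ≤ ‖θ‖²`;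
  **`norm_one_sub_pow_prime_ne_level`** — if every `t ∈ 𝒪` is congruent to a rational integer mod `𝔪` (`f = 1`)
  and `ζ^p = 1 ≠ ζ`, then NO `u` has `‖1 − u^p‖ = ‖ϖ‖^{A·p}` either (a level-`A` unit is `ζ^i·w` with `w` deep).

References: [cite: NeukirchANT1999, Ch. II Prop. (5.5)–(5.7)] [cite: Washington1997, Lemma 1.4, §5.1].  Classical
local `p`-adic analysis; `logUnits`/`unitLog` are the cell's typings of [IUTchIV] Prop. 1.2's `log_p(R^×)`
([claim: Mochizuki2012, status: disputed] for that locution only).  Consumer (record only): the sequel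
`UnitLogInnerRadiusDeepTie.lean` (D-0079 R-W lane U, column «rho_in», lower reading at wild places).  Nothing
here is disputed mathematics; no IUT statement is asserted; nothing bears on [IUTchIII] Cor. 3.12.
-/

noncomputable section

open Metric Set
open scoped NormedField

namespace Literature.IUT.LogVolume

namespace LogEnvelope

open RamificationCriterion BoundaryRamification Literature.NumberTheory.GaloisRepresentations.Ultrametric
  Literature.NumberTheory.Transcendental

/-- A root of unity of a normed field has norm `1`. [cite: NeukirchANT1999, Ch. II Prop. (5.7)] -/
theorem norm_eq_one_of_pow_eq_one_of_pos {L : Type*} [NormedField L] {η : L} {n : ℕ} (hn : 0 < n)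
    (h : η ^ n = 1) : ‖η‖ = 1 := by
  have h1 : ‖η‖ ^ n = 1 := by rw [← norm_pow, h, norm_one]
  exact (pow_eq_one_iff_of_nonneg (norm_nonneg η) hn.ne').mp h1

section Field

variable (p : ℕ) [hp : Fact p.Prime]
variable {K : Type*} [NontriviallyNormedField K] [instK : NormedAlgebra ℚ_[p] K] [IsUltrametricDist K]
  [ProperSpace K]
variable {ϖ : Kˣ} (hϖ : IsUniformizer ϖ) {A : ℕ} (hA : absRamificationIdx p K = A * (p - 1))
include hϖ hA

/-! ### §0. Index bookkeeping at a tie -/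

omit hϖ in
/-- `e + A = A·p` at a tie index `e = A·(p−1)`. [cite: NeukirchANT1999, Ch. II (5.5)] -/
theorem absRamificationIdx_add_level : absRamificationIdx p K + A = A * p := by
  rw [hA]
  have hp1 : 1 ≤ p := hp.out.one_le
  calc A * (p - 1) + A = A * (p - 1 + 1) := by ring
    _ = A * p := by rw [Nat.sub_add_cancel hp1]

omit hϖ in
/-- `A + 1 ≤ A·p − 1` for `p` odd (`A ≥ 1`, `p ≥ 3`). [cite: NeukirchANT1999, Ch. II (5.5)] -/
theorem level_succ_le_pred (hp2 : p ≠ 2) : A + 1 ≤ A * p - 1 := by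
  have hA1 := one_le_level p hA
  have hp3 : 3 ≤ p := by
    have h2 := hp.out.two_le
    omega
  have : A * 3 ≤ A * p := Nat.mul_le_mul_left A hp3
  omega

omit hA [IsUltrametricDist K] [ProperSpace K] in
/-- The level of a principal unit `u ≠ 1` is `‖1 − u‖ = ‖ϖ‖^m` for some `m ≥ 1`.
[cite: NeukirchANT1999, Ch. II (5.5)] -/
theorem exists_norm_one_sub_eq_pow {u : K} (hu : IsPrincipal u) (hu1 : u ≠ 1) :
    ∃ m : ℕ, 1 ≤ m ∧ ‖1 - u‖ = ‖(ϖ : K)‖ ^ m := by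
  have hρ0 : 0 < ‖(ϖ : K)‖ := norm_units_pos ϖ
  have hx : (1 : K) - u ≠ 0 := sub_ne_zero.mpr (Ne.symm hu1)
  obtain ⟨s, hs⟩ := hϖ.2 (Units.mk0 (1 - u) hx)
  rw [Units.val_mk0] at hs
  have hs1 : 1 ≤ s := by
    have h1 : ‖(ϖ : K)‖ ^ s < 1 := hs ▸ hu
    have := (zpow_lt_one_iff_right_of_lt_one₀ hρ0 hϖ.1).mp h1
    omega
  refine ⟨s.toNat, by omega, ?_⟩
  rw [hs, ← zpow_natCast, Int.toNat_of_nonneg (by omega)]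

/-! ### §1. Levels of `p`-th powers -/

/-- **Above the critical level the `p`-th power map shifts the level by `e`**: for `‖1 − w‖ ≤ ‖ϖ‖^{A+1}`,
`‖1 − w^p‖ = ‖p‖·‖1 − w‖` (both `w` and `w^p` lie in the isometry range of `log_p`, and
`log_p(w^p) = p·log_p w`). [cite: NeukirchANT1999, Ch. II Prop. (5.5)] -/
theorem norm_one_sub_pow_prime_eq_of_deep {w : K} (hw : ‖1 - w‖ ≤ ‖(ϖ : K)‖ ^ (A + 1)) :
    ‖1 - w ^ p‖ = ‖(p : K)‖ * ‖1 - w‖ := by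
  have hρ0 : 0 < ‖(ϖ : K)‖ := norm_units_pos ϖ
  have hθ := pow_level_succ_mul_rpow_lt_one p hϖ hA
  have hlt1 : ‖(ϖ : K)‖ ^ (A + 1) < 1 := pow_lt_one₀ hρ0.le hϖ.1 (by omega)
  have hwP : IsPrincipal w := hw.trans_lt hlt1
  have hw1 : ‖w‖ = 1 := hwP.norm_eq_one
  -- `w^p` is at least as deep as `w`
  have hwp : ‖1 - w ^ p‖ ≤ ‖(ϖ : K)‖ ^ (A + 1) := by
    refine (norm_one_sub_pow_prime_le p K hwP.le).trans ?_
    calc ‖1 - w‖ * max ‖(p : K)‖ (‖1 - w‖ ^ (p - 1)) ≤ ‖1 - w‖ * 1 := by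
          refine mul_le_mul_of_nonneg_left (max_le ?_ ?_) (norm_nonneg _)
          · exact IwasawaLog.norm_natCast_le_one p (F := K) p
          · exact pow_le_one₀ (norm_nonneg _) hwP.le
      _ ≤ ‖(ϖ : K)‖ ^ (A + 1) := by rw [mul_one]; exact hw
  have h1 := TorsionPowerCriterion.norm_unitLog_eq_norm_one_sub p hθ hw
  have h2 := TorsionPowerCriterion.norm_unitLog_eq_norm_one_sub p hθ hwp
  rw [← h2, unitLog_pow p hw1, norm_mul, h1]

/-- **At the critical level the `p`-th power is at least `e` deeper**: `‖1 − u‖ ≤ ‖ϖ‖^A ⇒ ‖1 − u^p‖ ≤ ‖ϖ‖^{A·p}`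
(`‖p‖ = ‖ϖ‖^{A(p−1)} = (‖ϖ‖^A)^{p−1}`). [cite: NeukirchANT1999, Ch. II Prop. (5.5)] -/
theorem norm_one_sub_pow_prime_le_of_level {u : K} (hu : ‖1 - u‖ ≤ ‖(ϖ : K)‖ ^ A) :
    ‖1 - u ^ p‖ ≤ ‖(ϖ : K)‖ ^ (A * p) := by
  have hρ0 : 0 < ‖(ϖ : K)‖ := norm_units_pos ϖ
  have hA1 := one_le_level p hA
  have hu1 : ‖1 - u‖ ≤ 1 := hu.trans (pow_le_one₀ hρ0.le hϖ.1.le)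
  refine (norm_one_sub_pow_prime_le p K hu1).trans ?_
  have hmax : max ‖(p : K)‖ (‖1 - u‖ ^ (p - 1)) ≤ ‖(ϖ : K)‖ ^ (A * (p - 1)) := by
    refine max_le ?_ ?_
    · rw [norm_prime_eq_norm_pow p K hϖ, hA]
    · calc ‖1 - u‖ ^ (p - 1) ≤ (‖(ϖ : K)‖ ^ A) ^ (p - 1) := pow_le_pow_left₀ (norm_nonneg _) hu _
        _ = ‖(ϖ : K)‖ ^ (A * (p - 1)) := (pow_mul _ _ _).symm
  calc ‖1 - u‖ * max ‖(p : K)‖ (‖1 - u‖ ^ (p - 1))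
      ≤ ‖(ϖ : K)‖ ^ A * ‖(ϖ : K)‖ ^ (A * (p - 1)) := by gcongr
    _ = ‖(ϖ : K)‖ ^ (A * p) := by
        rw [← pow_add, ← hA, add_comm, absRamificationIdx_add_level p hA]

/-- **No `p`-th power of a unit sits at level `A·p − 1`** (`p` odd, `e = A(p−1)`): `‖1 − u^p‖ ≠ ‖ϖ‖^{A·p−1}` for
every `u : K`.  Levels `a < A` give `a·p` (`≢ −1 (mod p)`), the critical level gives `≥ A·p`, and levels
`≥ A + 1` give `a + e ≥ A·p + 1`. [cite: NeukirchANT1999, Ch. II Prop. (5.5)] -/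
theorem norm_one_sub_pow_prime_ne_pred (hp2 : p ≠ 2) (u : K) :
    ‖1 - u ^ p‖ ≠ ‖(ϖ : K)‖ ^ (A * p - 1) := by
  intro h
  have hρ0 : 0 < ‖(ϖ : K)‖ := norm_units_pos ϖ
  have hA1 := one_le_level p hA
  have hAp := level_succ_le_pred p hA hp2
  have heA := absRamificationIdx_add_level p hA
  have hpP : IsPrincipal (u ^ p) := by
    show ‖1 - u ^ p‖ < 1
    rw [h]; exact pow_lt_one₀ hρ0.le hϖ.1 (by omega)
  have hun : ‖u‖ = 1 := norm_eq_one_of_isPrincipal_pow hp.out.pos hpP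
  have huP : IsPrincipal u := IsPrincipal.of_pow_prime (p := p) hun.le hpP
  by_cases hu1 : u = 1
  · rw [hu1, one_pow, sub_self, norm_zero] at h
    exact (ne_of_gt (pow_pos hρ0 _)) h.symm
  obtain ⟨m, hm1, hm⟩ := exists_norm_one_sub_eq_pow hϖ huP hu1
  rcases Nat.lt_or_ge m A with hmA | hmA
  · -- level below `A`: the `p`-th power has level `m·p`
    have hx : ‖u - 1‖ = ‖(ϖ : K)‖ ^ m := by rw [← norm_neg, neg_sub, hm]
    have hlev := norm_one_sub_pow_prime_eq_of_lt_level p hϖ hA hmA hx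
    rw [add_sub_cancel, h] at hlev
    have hexp := pow_right_injective₀ hρ0 hϖ.1.ne hlev
    have hle : m * p + p ≤ A * p := by
      have := Nat.mul_le_mul_right p (Nat.succ_le_of_lt hmA)
      rwa [Nat.succ_mul] at this
    have hp2' := hp.out.two_le
    omega
  · rcases hmA.eq_or_lt with hmA' | hmA'
    · -- the critical level: `‖1 − u^p‖ ≤ ‖ϖ‖^{A·p} < ‖ϖ‖^{A·p−1}`
      have hle := norm_one_sub_pow_prime_le_of_level p hϖ hA (u := u) (by rw [hm, hmA'])
      rw [h] at hle
      exact absurd hle (not_le.mpr (pow_lt_pow_right_of_lt_one₀ hρ0 hϖ.1 (by omega)))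
    · -- above the critical level: `‖1 − u^p‖ = ‖ϖ‖^{e+m}` with `e + m ≥ A·p + 1`
      have hdeep : ‖1 - u‖ ≤ ‖(ϖ : K)‖ ^ (A + 1) := by
        rw [hm]; exact pow_le_pow_of_le_one hρ0.le hϖ.1.le hmA'
      have hlev := norm_one_sub_pow_prime_eq_of_deep p hϖ hA hdeep
      rw [h, hm, norm_prime_eq_norm_pow p K hϖ, ← pow_add] at hlev
      have hexp := pow_right_injective₀ hρ0 hϖ.1.ne hlev
      omega

omit hϖ hA [ProperSpace K] in
include instK in
/-- Binomial estimate: `‖(1 + θ)^i − 1 − i·θ‖ ≤ ‖θ‖²` for `‖θ‖ ≤ 1` (all later binomial terms are multiples of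
`θ²` with integral coefficients). [cite: NeukirchANT1999, Ch. II (5.5)] -/
theorem norm_one_add_pow_sub_sub_le {θ : K} (hθ : ‖θ‖ ≤ 1) (i : ℕ) :
    ‖(1 + θ) ^ i - 1 - (i : K) * θ‖ ≤ ‖θ‖ ^ 2 := by
  induction i with
  | zero => simp
  | succ i ih =>
    have hstep : (1 + θ) ^ (i + 1) - 1 - ((i + 1 : ℕ) : K) * θ =
        (1 + θ) * ((1 + θ) ^ i - 1 - (i : K) * θ) + (i : K) * θ ^ 2 := by
      push_cast; ring
    rw [hstep]
    refine (IsUltrametricDist.norm_add_le_max _ _).trans (max_le ?_ ?_)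
    · rw [norm_mul]
      calc ‖1 + θ‖ * ‖(1 + θ) ^ i - 1 - (i : K) * θ‖ ≤ 1 * ‖θ‖ ^ 2 := by
            refine mul_le_mul ?_ ih (norm_nonneg _) zero_le_one
            exact (IsUltrametricDist.norm_add_le_max _ _).trans (max_le (by rw [norm_one]) hθ)
        _ = ‖θ‖ ^ 2 := one_mul _
    · rw [norm_mul, norm_pow]
      calc ‖(i : K)‖ * ‖θ‖ ^ 2 ≤ 1 * ‖θ‖ ^ 2 := by
            gcongr; exact IwasawaLog.norm_natCast_le_one p (F := K) i
        _ = ‖θ‖ ^ 2 := one_mul _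

/-- **When `f = 1` and `ζ_p ∈ K`, no `p`-th power sits at level `A·p` either.**  Hypotheses: every `t ∈ 𝒪` is
congruent to a rational integer modulo `𝔪` (residue field `𝔽_p`), and `ζ^p = 1 ≠ ζ`.  A unit `u` at the critical
level is then `≡ ζ^i (mod 𝔪^{A+1})`, so `u^p = (u·ζ^{−i})^p` has level `≥ A·p + 1`; the other levels are as in
`norm_one_sub_pow_prime_ne_pred`. [cite: NeukirchANT1999, Ch. II Prop. (5.5)–(5.7)] -/
theorem norm_one_sub_pow_prime_ne_level
    (hf : ∀ t : K, ‖t‖ ≤ 1 → ∃ i : ℕ, i < p ∧ ‖t - i‖ < 1) {ζ : K} (hζ : ζ ^ p = 1) (hζ1 : ζ ≠ 1)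
    (u : K) : ‖1 - u ^ p‖ ≠ ‖(ϖ : K)‖ ^ (A * p) := by
  intro h
  have hρ0 : 0 < ‖(ϖ : K)‖ := norm_units_pos ϖ
  have hA1 := one_le_level p hA
  have heA := absRamificationIdx_add_level p hA
  have hpP : IsPrincipal (u ^ p) := by
    show ‖1 - u ^ p‖ < 1
    rw [h]; exact pow_lt_one₀ hρ0.le hϖ.1 (Nat.mul_pos (by omega) hp.out.pos).ne'
  have hun : ‖u‖ = 1 := norm_eq_one_of_isPrincipal_pow hp.out.pos hpP
  have huP : IsPrincipal u := IsPrincipal.of_pow_prime (p := p) hun.le hpP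
  by_cases hu1 : u = 1
  · rw [hu1, one_pow, sub_self, norm_zero] at h
    exact (ne_of_gt (pow_pos hρ0 _)) h.symm
  obtain ⟨m, hm1, hm⟩ := exists_norm_one_sub_eq_pow hϖ huP hu1
  rcases Nat.lt_or_ge m A with hmA | hmA
  · have hx : ‖u - 1‖ = ‖(ϖ : K)‖ ^ m := by rw [← norm_neg, neg_sub, hm]
    have hlev := norm_one_sub_pow_prime_eq_of_lt_level p hϖ hA hmA hx
    rw [add_sub_cancel, h] at hlev
    have hexp := pow_right_injective₀ hρ0 hϖ.1.ne hlev
    have := Nat.eq_of_mul_eq_mul_right hp.out.pos hexp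
    omega
  rcases hmA.eq_or_lt with hmA' | hmA'
  · -- the critical level: `u ≡ ζ^i (mod 𝔪^{A+1})`
    have hζA := norm_one_sub_eq_pow_level_of_pow_prime_eq_one p hϖ hA hζ hζ1
    set θ : K := ζ - 1 with hθdef
    set x : K := u - 1 with hxdef
    have hθn : ‖θ‖ = ‖(ϖ : K)‖ ^ A := by rw [hθdef, ← norm_neg, neg_sub, hζA]
    have hxn : ‖x‖ = ‖(ϖ : K)‖ ^ A := by rw [hxdef, ← norm_neg, neg_sub, hm, hmA']
    have hθ0 : θ ≠ 0 := norm_pos_iff.mp (by rw [hθn]; exact pow_pos hρ0 _)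
    have hθ1 : ‖θ‖ ≤ 1 := by rw [hθn]; exact pow_le_one₀ hρ0.le hϖ.1.le
    have ht : ‖x / θ‖ ≤ 1 := by rw [norm_div, hxn, hθn, div_self (pow_pos hρ0 _).ne']
    obtain ⟨i, -, hi⟩ := hf (x / θ) ht
    -- `‖x − i·θ‖ ≤ ‖ϖ‖^{A+1}`
    have hxi : ‖x - (i : K) * θ‖ ≤ ‖(ϖ : K)‖ ^ (A + 1) := by
      have hfac : x - (i : K) * θ = (x / θ - i) * θ := by field_simp
      rw [hfac, norm_mul, hθn, pow_succ']
      exact mul_le_mul_of_nonneg_right (hϖ.norm_le_of_norm_lt_one _ hi) (pow_nonneg hρ0.le _)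
    -- `‖u − ζ^i‖ ≤ ‖ϖ‖^{A+1}`
    have huζ : ‖u - ζ ^ i‖ ≤ ‖(ϖ : K)‖ ^ (A + 1) := by
      have hsplit : u - ζ ^ i = (x - (i : K) * θ) - ((1 + θ) ^ i - 1 - (i : K) * θ) := by
        rw [hxdef, hθdef, add_sub_cancel]; ring
      rw [hsplit, sub_eq_add_neg]
      refine (IsUltrametricDist.norm_add_le_max _ _).trans (max_le hxi ?_)
      rw [norm_neg]
      refine (norm_one_add_pow_sub_sub_le p hθ1 i).trans ?_
      rw [hθn, ← pow_mul]
      exact pow_le_pow_of_le_one hρ0.le hϖ.1.le (by omega)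
    -- `w := u·ζ^{−i}` is deep and `w^p = u^p`
    have hζn : ‖ζ‖ = 1 := norm_eq_one_of_pow_eq_one_of_pos hp.out.pos hζ
    have hζi0 : ζ ^ i ≠ 0 := pow_ne_zero _ (norm_pos_iff.mp (by rw [hζn]; exact one_pos))
    set w : K := u * (ζ ^ i)⁻¹ with hwdef
    have hw : ‖1 - w‖ ≤ ‖(ϖ : K)‖ ^ (A + 1) := by
      have : (1 : K) - w = -((u - ζ ^ i) * (ζ ^ i)⁻¹) := by rw [hwdef]; field_simp; ring
      rw [this, norm_neg, norm_mul, norm_inv, norm_pow, hζn, one_pow, inv_one, mul_one]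
      exact huζ
    have hwp : w ^ p = u ^ p := by
      rw [hwdef, mul_pow, inv_pow, ← pow_mul, mul_comm i p, pow_mul, hζ, one_pow, inv_one, mul_one]
    have hlev := norm_one_sub_pow_prime_eq_of_deep p hϖ hA hw
    rw [hwp, h, norm_prime_eq_norm_pow p K hϖ] at hlev
    -- `‖ϖ‖^{A·p} = ‖ϖ‖^e·‖1 − w‖ ≤ ‖ϖ‖^{e + A + 1}`: contradiction
    have hle : ‖(ϖ : K)‖ ^ (A * p) ≤ ‖(ϖ : K)‖ ^ (absRamificationIdx p K + (A + 1)) := by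
      rw [hlev, pow_add]
      exact mul_le_mul_of_nonneg_left hw (pow_nonneg hρ0.le _)
    exact absurd hle (not_le.mpr (pow_lt_pow_right_of_lt_one₀ hρ0 hϖ.1 (by omega)))
  · have hdeep : ‖1 - u‖ ≤ ‖(ϖ : K)‖ ^ (A + 1) := by
      rw [hm]; exact pow_le_pow_of_le_one hρ0.le hϖ.1.le hmA'
    have hlev := norm_one_sub_pow_prime_eq_of_deep p hϖ hA hdeep
    rw [h, hm, norm_prime_eq_norm_pow p K hϖ, ← pow_add] at hlev
    have hexp := pow_right_injective₀ hρ0 hϖ.1.ne hlev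
    omega

end Field

end LogEnvelope

end Literature.IUT.LogVolume

end
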